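import Literature.AlgebraicGeometry.Resolution.SmoothDescentStandardEtale
import Literature.AlgebraicGeometry.Resolution.InseparableLocalUniformizationLemmas
import Mathlib.RingTheory.Flat.EquationalCriterion
import Mathlib.Algebra.Module.Torsion.Basic
import HarnessLib

/-!
# Descent of smoothness through smooth covers (Stacks 05B5, smooth case) — the Step-4 input of Temkin 2013

Topic: `Literature/AlgebraicGeometry/Resolution`. M. Temkin, *Inseparable local uniformization*,
J. Algebra 373 (2013) 65–119 = arXiv:0804.1554v3, proof of Thm. 4.1.1, Step 4 (p. 49): "Then
(the new) `yᵢ` is `l`-smooth by the construction and `xᵢ` is still smooth-equivalent to `yᵢ` by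
Lemma 2.8.5 … Thus, we achieve that the center of each `Kᵢ` on `Xᵢ` is `l`-smooth". Passing
from "smooth-equivalent to an `l`-smooth point" to "`l`-smooth" is DESCENT OF SMOOTHNESS along
the smooth cover `Z → Xᵢ` of Definition 2.8.1 (The Stacks Project, Tag 05B5; EGA IV 17.7.7).
In the tree this was the undischarged named fact `Stacks05B5`
(`InseparableLocalUniformizationLemmas.lean`, fppf form), feeding
`Stacks05B5.isSmoothAt_comap` and `AreSmoothEquivalent.isSmoothAt_left'`. This file PROVES the
smooth-cover form that those uses need, unconditionally:

* `projective_kaehlerDifferential_of_smooth_cover` — for `R₀ → R → S` with `S` smooth and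
  faithfully flat over `R`, formally smooth over `R₀`, and `R/R₀` of finite presentation,
  `Ω_{R/R₀}` is projective: `S ⊗_R Ω_{R/R₀} ↪ Ω_{S/R₀}` (kernel = image of `H₁(L_{S/R}) = 0`)
  with projective cokernel `Ω_{S/R}`, so it is a direct summand of a projective module; flatness
  descends along faithfully flat maps (`Module.Flat.of_flat_tensorProduct`), and finitely
  presented flat modules are projective.
* `subsingleton_tensor_h1Cotangent_of_smooth` — `S ⊗_R H₁(L_{R/R₀}) = 0`: locally `S` is
  standard étale over a polynomial ring over `R`
  (`Algebra.IsSmoothAt.exists_isStandardEtale_mvPolynomial`), where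
  `StandardEtaleKoszul.subsingleton_tensor_h1Cotangent` (`SmoothDescentStandardEtale.lean`)
  applies, and an element annihilated by a power of an element outside each maximal ideal is `0`.
* `formallySmooth_of_smooth_cover`, `smooth_of_smooth_cover` — **descent of (formal)
  smoothness through a smooth faithfully flat cover** (`H₁ = 0` by faithful flatness,
  `Module.FaithfullyFlat.lTensor_reflects_triviality`; Mathlib's `Algebra.FormallySmooth` is
  "`Ω` projective and `H₁(L) = 0`").
* `Stacks05B5_smooth` — NAMED FACT rendering Tag 05B5 in the smooth-cover, finite-presentation
  case, DISCHARGED: `Stacks05B5_smooth_holds`; and `Stacks05B5.smooth : Stacks05B5 →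
  Stacks05B5_smooth` (the fppf named fact implies it).
* `isSmoothAt_comap_of_smooth` — the POINTWISE form (the proof of `Stacks05B5.isSmoothAt_comap`
  with the named fact replaced by `smooth_of_smooth_cover`), and
  `AreSmoothEquivalent.isSmoothAt_of_isSmoothAt'`, `AreSmoothEquivalent.isSmoothAt_of_isSmoothAt` —
  **a point smooth-equivalent to a `Λ`-smooth point is `Λ`-smooth**, i.e.
  `AreSmoothEquivalent.isSmoothAt_left'`/`isSmoothAt_left` WITHOUT the hypothesis
  `(h05 : Stacks05B5)`. This removes `Stacks05B5` from the inputs of Steps 3–4 of the proof of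
  Thm. 4.1.1 (`Temkin2013_Steps34_tower`, `InseparableLocalUniformizationEngineTower.lean`).

Relation to `SmoothDescentField.lean` (landed independently while this file was written): there
the POINTWISE statement is proved for a FIELD `Λ = l` and `A` of finite type, by transport of
regularity along the smooth cover (EGA IV 17.5.8 (iii)), a purely inseparable enlargement of
the constants and Stacks 00TV; here the base `Λ = R₀` is an arbitrary commutative ring, the
global statement (`smooth_of_smooth_cover`) is proved first, by the cotangent-complex argument,
and the field case is the special case `Λ = l` of `isSmoothAt_comap_of_smooth`.

What is NOT here: the general fppf form of Tag 05B5 (cover flat, surjective and of finite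
presentation but not smooth, no finite-presentation hypothesis on `R/R₀`), whose proof needs
"geometrically regular ⇒ smooth" over fields; it stays the named fact `Stacks05B5`.

## Sources

* The Stacks Project, Tag 05B5 ("Let `X → Y → S` … Assume that (1) `f` is surjective, flat, and
  locally of finite presentation, (2) `p` is smooth. Then `q` is smooth."); Tags 00S2, 00UE.
* M. Temkin, *Inseparable local uniformization*, arXiv:0804.1554v3, Definition 2.8.1 and the
  remark after it (p. 30), proof of Thm. 4.1.1, Step 4 (p. 49).
-/

noncomputable section

open KaehlerDifferential Module TensorProduct

namespace Literature.AlgebraicGeometry.Resolution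

section Descent

universe u

variable {R₀ R S : Type u} [CommRing R₀] [CommRing R] [CommRing S] [Algebra R₀ R] [Algebra R₀ S]
  [Algebra R S] [IsScalarTower R₀ R S]

/-- **`Ω_{R/R₀}` is projective when `R` has a smooth faithfully flat cover `S` which is formally
smooth over `R₀`** (and `R/R₀` is of finite presentation): `S ⊗_R Ω_{R/R₀} → Ω_{S/R₀}` is
injective (its kernel is the image of `H₁(L_{S/R}) = 0`) with projective cokernel `Ω_{S/R}`,
so `S ⊗_R Ω_{R/R₀}` is a direct summand of the projective `Ω_{S/R₀}`; hence `Ω_{R/R₀}` is flat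
by faithfully flat descent, and projective being finitely presented. [folklore] -/
theorem projective_kaehlerDifferential_of_smooth_cover [Algebra.Smooth R S]
    [Module.FaithfullyFlat R S] [Algebra.FormallySmooth R₀ S] [Algebra.FinitePresentation R₀ R] :
    Module.Projective R Ω[R⁄R₀] := by
  -- injectivity of `S ⊗ Ω[R/R₀] → Ω[S/R₀]`
  have hinj : Function.Injective (KaehlerDifferential.mapBaseChange R₀ R S) := by
    intro x y hxy
    have hex := Algebra.H1Cotangent.exact_δ_mapBaseChange R₀ R S
    rw [← sub_eq_zero, ← map_sub] at hxy
    obtain ⟨z, hz⟩ := (hex (x - y)).mp hxy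
    rw [Subsingleton.elim z 0, map_zero] at hz
    exact (sub_eq_zero.mp hz.symm)
  -- a section of `Ω[S/R₀] → Ω[S/R]`
  obtain ⟨sct, hsct⟩ := Module.projective_lifting_property (KaehlerDifferential.map R₀ R S S)
    LinearMap.id (KaehlerDifferential.map_surjective R₀ R S)
  have hsct' : ∀ w, KaehlerDifferential.map R₀ R S S (sct w) = w := fun w =>
    LinearMap.congr_fun hsct w
  -- the induced retraction of `mapBaseChange`
  have hrange : ∀ x : Ω[S⁄R₀], x - sct (KaehlerDifferential.map R₀ R S S x) ∈
      LinearMap.range (KaehlerDifferential.mapBaseChange R₀ R S) := by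
    intro x
    apply ((KaehlerDifferential.exact_mapBaseChange_map R₀ R S) _).mp
    rw [map_sub, hsct', sub_self]
  let e := LinearEquiv.ofInjective _ hinj
  let ψ : Ω[S⁄R₀] →ₗ[S] LinearMap.range (KaehlerDifferential.mapBaseChange R₀ R S) :=
    LinearMap.codRestrict _ (LinearMap.id - sct ∘ₗ KaehlerDifferential.map R₀ R S S) hrange
  let r : Ω[S⁄R₀] →ₗ[S] S ⊗[R] Ω[R⁄R₀] := e.symm.toLinearMap ∘ₗ ψ
  have hr : r ∘ₗ KaehlerDifferential.mapBaseChange R₀ R S = LinearMap.id := by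
    apply LinearMap.ext
    intro y
    change e.symm (ψ (KaehlerDifferential.mapBaseChange R₀ R S y)) = y
    rw [LinearEquiv.symm_apply_eq]
    apply Subtype.ext
    change KaehlerDifferential.mapBaseChange R₀ R S y -
        sct (KaehlerDifferential.map R₀ R S S (KaehlerDifferential.mapBaseChange R₀ R S y)) =
      KaehlerDifferential.mapBaseChange R₀ R S y
    have h0 : KaehlerDifferential.map R₀ R S S (KaehlerDifferential.mapBaseChange R₀ R S y) = 0 :=
      ((KaehlerDifferential.exact_mapBaseChange_map R₀ R S) _).mpr ⟨y, rfl⟩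
    rw [h0, map_zero, sub_zero]
  haveI : Module.Projective S (S ⊗[R] Ω[R⁄R₀]) :=
    Module.Projective.of_split (KaehlerDifferential.mapBaseChange R₀ R S) r hr
  haveI : Module.Flat R Ω[R⁄R₀] := Module.Flat.of_flat_tensorProduct R _ S
  exact Module.Flat.projective_of_finitePresentation

/-- **`S ⊗_R H₁(L_{R/R₀}) = 0` for a smooth `R`-algebra `S` formally smooth over `R₀`**:
locally on `S`, `S` is standard étale over a polynomial ring over `R`
(`Algebra.IsSmoothAt.exists_isStandardEtale_mvPolynomial`), where
`StandardEtaleKoszul.subsingleton_tensor_h1Cotangent` applies; an element killed by a power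
of an element outside every maximal ideal is zero. [folklore] -/
theorem subsingleton_tensor_h1Cotangent_of_smooth [Algebra.Smooth R S]
    [Algebra.FormallySmooth R₀ S] : Subsingleton (S ⊗[R] Algebra.H1Cotangent R₀ R) := by
  suffices key : ∀ m : S ⊗[R] Algebra.H1Cotangent R₀ R, m = 0 from
    ⟨fun a b => by rw [key a, key b]⟩
  intro m
  by_contra hm
  have hI : Ideal.torsionOf S _ m ≠ ⊤ := by
    intro htop
    apply hm
    have h1 : (1 : S) ∈ Ideal.torsionOf S _ m := by rw [htop]; exact Submodule.mem_top
    rw [Ideal.mem_torsionOf_iff, one_smul] at h1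
    exact h1
  obtain ⟨𝔮, h𝔮, hle⟩ := Ideal.exists_le_maximal _ hI
  haveI := h𝔮.isPrime
  haveI : Algebra.IsSmoothAt R 𝔮 := by
    have : (⟨𝔮, inferInstance⟩ : PrimeSpectrum S) ∈ Algebra.smoothLocus R S := by
      rw [Algebra.smoothLocus_eq_univ]; trivial
    exact this
  obtain ⟨g, hg𝔮, n, _inst, htower, hstd⟩ :=
    Algebra.IsSmoothAt.exists_isStandardEtale_mvPolynomial (R := R) (p := 𝔮)
  haveI := htower
  haveI := hstd
  haveI : Algebra.FormallySmooth S (Localization.Away g) :=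
    Algebra.FormallySmooth.of_isLocalization (Submonoid.powers g)
  haveI : Algebra.FormallySmooth R₀ (Localization.Away g) :=
    Algebra.FormallySmooth.comp R₀ S (Localization.Away g)
  haveI hsub : Subsingleton (Localization.Away g ⊗[R] Algebra.H1Cotangent R₀ R) :=
    StandardEtaleKoszul.subsingleton_tensor_h1Cotangent (R := R₀) (S := R)
      (T := Localization.Away g) n
  let φ := TensorProduct.AlgebraTensorModule.rTensor R (Algebra.H1Cotangent R₀ R)
    (Algebra.linearMap S (Localization.Away g))
  have h0 : φ m = 0 := Subsingleton.elim _ _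
  obtain ⟨⟨u, k, rfl⟩, hu⟩ := (IsLocalizedModule.eq_zero_iff (Submonoid.powers g) φ).mp h0
  have hmem : g ^ k ∈ Ideal.torsionOf S _ m := by
    rw [Ideal.mem_torsionOf_iff]
    exact hu
  exact hg𝔮 (h𝔮.isPrime.mem_of_pow_mem k (hle hmem))

/-- **Descent of formal smoothness through a smooth faithfully flat cover** (The Stacks
Project, Tag 05B5, in the case where the cover `R → S` is smooth and `R₀ → R` is of finite
presentation; affine form): `Ω_{R/R₀}` is projective
(`projective_kaehlerDifferential_of_smooth_cover`) and `H₁(L_{R/R₀}) = 0` because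
`S ⊗_R H₁(L_{R/R₀}) = 0` (`subsingleton_tensor_h1Cotangent_of_smooth`) and `S` is faithfully
flat over `R`. [cite: StacksProject, Tag 05B5] -/
theorem formallySmooth_of_smooth_cover [Algebra.Smooth R S] [Module.FaithfullyFlat R S]
    [Algebra.FormallySmooth R₀ S] [Algebra.FinitePresentation R₀ R] :
    Algebra.FormallySmooth R₀ R := by
  haveI := projective_kaehlerDifferential_of_smooth_cover (R₀ := R₀) (R := R) (S := S)
  haveI := subsingleton_tensor_h1Cotangent_of_smooth (R₀ := R₀) (R := R) (S := S)
  haveI : Subsingleton (Algebra.H1Cotangent R₀ R) :=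
    Module.FaithfullyFlat.lTensor_reflects_triviality R S _
  exact ⟨inferInstance, inferInstance⟩

/-- The same with `Algebra.Smooth` (finite presentation added). [cite: StacksProject, Tag 05B5] -/
theorem smooth_of_smooth_cover [Algebra.Smooth R S] [Module.FaithfullyFlat R S]
    [Algebra.Smooth R₀ S] [Algebra.FinitePresentation R₀ R] : Algebra.Smooth R₀ R :=
  ⟨formallySmooth_of_smooth_cover (R₀ := R₀) (R := R) (S := S), inferInstance⟩

/-- NAMED FACT (PROVED below: `Stacks05B5_smooth_holds`) — **smoothness descends through a
smooth faithfully flat cover** (The Stacks Project, Tag 05B5: "Let `X → Y → S` be morphisms of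
schemes [`f : X → Y`, `p : X → S`, `q : Y → S`]. Assume that (1) `f` is surjective, flat, and
locally of finite presentation, (2) `p` is smooth. Then `q` is smooth."), affine form, in the
SPECIAL CASE where the cover `f` is moreover smooth and `q` is already known to be of finite
presentation — the case used in Temkin 2013, proof of Thm. 4.1.1, Step 4 ("`x₁` is `l`-smooth":
descent of smoothness along the smooth cover `Z → X₁` of a smooth-equivalence over a variety).
The general fppf form is the named fact `Stacks05B5` (`InseparableLocalUniformizationLemmas.lean`),
of which this is a consequence (`Stacks05B5.smooth`). [cite: StacksProject, Tag 05B5] -/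
def Stacks05B5_smooth : Prop :=
  ∀ (Λ A B : Type u) [CommRing Λ] [CommRing A] [CommRing B] [Algebra Λ A] [Algebra Λ B]
    [Algebra A B] [IsScalarTower Λ A B],
    Algebra.FinitePresentation Λ A → Module.FaithfullyFlat A B → Algebra.Smooth A B →
      Algebra.Smooth Λ B → Algebra.Smooth Λ A

/-- **Stacks 05B5, smooth-cover case — PROVED** (from Mathlib's local structure of smooth
algebras, the Jacobi–Zariski sequence and faithfully flat descent of flatness).
[cite: StacksProject, Tag 05B5] -/
theorem Stacks05B5_smooth_holds : Stacks05B5_smooth.{u} := by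
  intro Λ A B _ _ _ _ _ _ _ hfp hff hAB hΛB
  exact smooth_of_smooth_cover (R₀ := Λ) (R := A) (S := B)

/-- The fppf form implies the smooth-cover form. [folklore] -/
theorem Stacks05B5.smooth (h : Stacks05B5.{u}) : Stacks05B5_smooth.{u} := by
  intro Λ A B _ _ _ _ _ _ _ hfp hff hAB hΛB
  exact h Λ A B hff inferInstance hΛB

end Descent

/-! ### Pointwise descent along a smooth morphism, and transfer along smooth-equivalence -/

section Pointwise

universe u

open IsLocalRing

/-- **Pointwise descent of smoothness along a smooth morphism — PROVED** (the form of
Stacks 05B5 used in Temkin 2013, proof of Thm. 4.1.1, Step 4, p. 49: "`xᵢ` are still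
smooth-equivalent to `yᵢ` … In particular, `x₁` is `l`-smooth"): if `A` is a finitely presented
`Λ`-algebra, `D` a smooth `A`-algebra and `r ⊂ D` a prime at which `D` is `Λ`-smooth, then `A` is
`Λ`-smooth at `r ∩ A`. The proof is that of `Stacks05B5.isSmoothAt_comap`
(`InseparableLocalUniformizationLemmas.lean`: shrink `D`, Chevalley's openness, a basic open
`D(a) ∋ p`, `A_a → (D_g)_a` faithfully flat of finite presentation) with the named fact
`Stacks05B5` replaced by the proved `smooth_of_smooth_cover` (`A_a → (D_g)_a` is smooth: formally
smooth over `A`, and `A → A_a` is formally étale). [cite: StacksProject, Tag 05B5] -/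
theorem isSmoothAt_comap_of_smooth {Λ A D : Type u}
    [CommRing Λ] [CommRing A] [CommRing D] [Algebra Λ A] [Algebra A D] [Algebra Λ D]
    [IsScalarTower Λ A D] [Algebra.FinitePresentation Λ A] [Algebra.Smooth A D]
    (r : Ideal D) [r.IsPrime] [Algebra.IsSmoothAt Λ r] :
    Algebra.IsSmoothAt Λ (r.comap (algebraMap A D)) := by
  classical
  haveI : Algebra.FinitePresentation Λ D := .trans Λ A D
  -- Step 1: `D_g` is `Λ`-smooth for some `g ∉ r`
  obtain ⟨g, hgr, hDg⟩ := Algebra.IsSmoothAt.exists_notMem_smooth Λ r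
  let Dg := Localization.Away g
  haveI : Algebra.Smooth D Dg := .of_isLocalization_Away g
  haveI : Algebra.Smooth A Dg := .comp A D Dg
  haveI : Algebra.Smooth Λ Dg := hDg
  -- the prime `r D_g` lies over `p = r ∩ A`
  have hdisj : Disjoint (↑(Submonoid.powers g) : Set D) ↑r := by
    refine Set.disjoint_left.mpr ?_
    rintro x ⟨n, rfl⟩ hx
    exact hgr (‹r.IsPrime›.mem_of_pow_mem n hx)
  let rg : Ideal Dg := r.map (algebraMap D Dg)
  haveI hrg : rg.IsPrime := IsLocalization.isPrime_of_isPrime_disjoint (Submonoid.powers g) Dg r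
    ‹r.IsPrime› hdisj
  have hrg_comap : rg.comap (algebraMap D Dg) = r :=
    IsLocalization.under_map_of_isPrime_disjoint (Submonoid.powers g) Dg ‹r.IsPrime› hdisj
  -- Step 2: the image of `Spec D_g → Spec A` is open and contains `p`
  have hopen : IsOpen (Set.range (PrimeSpectrum.comap (algebraMap A Dg))) :=
    (PrimeSpectrum.isOpenMap_comap_of_hasGoingDown_of_finitePresentation).isOpen_range
  have hpmem : (⟨r.comap (algebraMap A D), inferInstance⟩ : PrimeSpectrum A) ∈
      Set.range (PrimeSpectrum.comap (algebraMap A Dg)) := by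
    refine ⟨⟨rg, hrg⟩, PrimeSpectrum.ext ?_⟩
    change rg.comap (algebraMap A Dg) = r.comap (algebraMap A D)
    rw [IsScalarTower.algebraMap_eq A D Dg, ← Ideal.comap_comap, hrg_comap]
  -- Step 3: a basic open `D(a) ∋ p` inside the image
  obtain ⟨_, ⟨_, ⟨a, rfl⟩, rfl⟩, hpa, haU⟩ :=
    PrimeSpectrum.isBasis_basic_opens.exists_subset_of_mem_open hpmem hopen
  -- Step 4: `A_a → E = (D_g)_a` is faithfully flat of finite presentation, `E` is `Λ`-smooth
  let Aa := Localization.Away a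
  let a' : Dg := algebraMap A Dg a
  let E := Localization.Away a'
  haveI : Algebra.Smooth Dg E := .of_isLocalization_Away a'
  haveI : Algebra.Smooth Λ E := .comp Λ Dg E
  haveI : Algebra.Smooth A E := .comp A Dg E
  have hunit : ∀ y : Submonoid.powers a, IsUnit (algebraMap A E y) := by
    rintro ⟨_, n, rfl⟩
    rw [map_pow]
    refine IsUnit.pow n ?_
    rw [IsScalarTower.algebraMap_apply A Dg E]
    exact IsLocalization.Away.algebraMap_isUnit a'
  letI : Algebra Aa E := (IsLocalization.lift (M := Submonoid.powers a) (S := Aa) hunit).toAlgebra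
  haveI : IsScalarTower A Aa E :=
    IsScalarTower.of_algebraMap_eq (fun x => (IsLocalization.lift_eq hunit x).symm)
  haveI : IsScalarTower Λ Aa E := IsScalarTower.of_algebraMap_eq fun x => by
    change algebraMap Λ E x = algebraMap Aa E (algebraMap Λ Aa x)
    rw [IsScalarTower.algebraMap_apply Λ A Aa, ← IsScalarTower.algebraMap_apply A Aa E,
      IsScalarTower.algebraMap_apply Λ Dg E, IsScalarTower.algebraMap_apply Λ D Dg,
      IsScalarTower.algebraMap_apply Λ A D, ← IsScalarTower.algebraMap_apply A D Dg,
      ← IsScalarTower.algebraMap_apply A Dg E]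
  haveI : Module.Flat A E := inferInstance
  haveI : Module.Flat Aa E :=
    (Module.flat_iff_of_isLocalization (S := Aa) (p := Submonoid.powers a) (M := E)).mpr ‹_›
  haveI : Algebra.FinitePresentation A Aa := IsLocalization.Away.finitePresentation a
  haveI : Algebra.FinitePresentation Aa E :=
    Algebra.FinitePresentation.of_restrict_scalars_finitePresentation A Aa E
  -- surjectivity of `Spec E → Spec A_a`
  have hsurj : Function.Surjective (PrimeSpectrum.comap (algebraMap Aa E)) := by
    intro P
    let P₀ : Ideal A := P.asIdeal.comap (algebraMap A Aa)
    haveI : P₀.IsPrime := Ideal.comap_isPrime _ _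
    have haP₀ : a ∉ P₀ := fun ha =>
      P.2.ne_top (Ideal.eq_top_of_isUnit_mem _ ha (IsLocalization.Away.algebraMap_isUnit a))
    have hP₀mem : (⟨P₀, inferInstance⟩ : PrimeSpectrum A) ∈ (PrimeSpectrum.basicOpen a : Set _) :=
      haP₀
    obtain ⟨Q₀, hQ₀⟩ := haU hP₀mem
    have hQ₀' : Q₀.asIdeal.comap (algebraMap A Dg) = P₀ := congrArg PrimeSpectrum.asIdeal hQ₀
    have ha'Q₀ : a' ∉ Q₀.asIdeal := fun h' => haP₀ (by rw [← hQ₀']; exact h')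
    have hdisj' : Disjoint (↑(Submonoid.powers a') : Set Dg) ↑Q₀.asIdeal := by
      refine Set.disjoint_left.mpr ?_
      rintro x ⟨n, rfl⟩ hx
      exact ha'Q₀ (Q₀.2.mem_of_pow_mem n hx)
    let Q : Ideal E := Q₀.asIdeal.map (algebraMap Dg E)
    haveI hQ : Q.IsPrime :=
      IsLocalization.isPrime_of_isPrime_disjoint (Submonoid.powers a') E Q₀.asIdeal Q₀.2 hdisj'
    refine ⟨⟨Q, hQ⟩, PrimeSpectrum.ext ?_⟩
    change Q.comap (algebraMap Aa E) = P.asIdeal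
    have key : (Q.comap (algebraMap Aa E)).comap (algebraMap A Aa) = P₀ := by
      rw [Ideal.comap_comap, ← IsScalarTower.algebraMap_eq A Aa E,
        IsScalarTower.algebraMap_eq A Dg E, ← Ideal.comap_comap]
      change Ideal.comap (algebraMap A Dg) (Ideal.under Dg (Ideal.map (algebraMap Dg E) Q₀.asIdeal)) = P₀
      rw [IsLocalization.under_map_of_isPrime_disjoint (Submonoid.powers a') E Q₀.2 hdisj', hQ₀']
    rw [← IsLocalization.map_under (Submonoid.powers a) Aa (Q.comap (algebraMap Aa E)),
      Ideal.under_def, key]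
    exact IsLocalization.map_under (Submonoid.powers a) Aa P.asIdeal
  haveI : Module.FaithfullyFlat Aa E := .of_comap_surjective hsurj
  haveI : Algebra.FormallyEtale A Aa := .of_isLocalization (.powers a)
  haveI : Algebra.FormallySmooth Aa E := Algebra.FormallySmooth.of_restrictScalars (R := A) Aa E
  haveI : Algebra.Smooth Aa E := ⟨‹_›, ‹_›⟩
  have hAa : Algebra.Smooth Λ Aa := smooth_of_smooth_cover (R₀ := Λ) (R := Aa) (S := E)
  -- conclusion: `D(a) ⊆` smooth locus
  have hsub : ↑(PrimeSpectrum.basicOpen a) ⊆ Algebra.smoothLocus Λ A :=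
    Algebra.basicOpen_subset_smoothLocus_iff.mpr hAa.formallySmooth
  exact hsub hpa

namespace AreSmoothEquivalent

variable {Λ R₀ A B : Type u} [CommRing Λ] [CommRing R₀] [CommRing A] [CommRing B]

/-- **A point smooth-equivalent to a `Λ`-smooth point is `Λ`-smooth — PROVED unconditionally**
(Temkin 2013, after Definition 2.8.1, p. 30, direction "⇒", and proof of Thm. 4.1.1, Step 4,
p. 49: "In particular, `x₁` is `l`-smooth"); this is `AreSmoothEquivalent.isSmoothAt_left'`
(`InseparableLocalUniformizationLemmas.lean`) with its hypothesis `Stacks05B5` discharged in the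
smooth-cover form actually used (`isSmoothAt_comap_of_smooth`): `(X, x)` and `(Y, y)`
smooth-equivalent over `S = Spec R₀`, `X = Spec A`, `Y = Spec B` finitely presented over `Λ`,
compatible `Λ`-structures on common smooth covers (`hΛ`); then `Y` `Λ`-smooth at `y` implies `X`
`Λ`-smooth at `x`. [cite: StacksProject, Tag 05B5] -/
theorem isSmoothAt_of_isSmoothAt' [Algebra Λ A] [Algebra Λ B]
    [Algebra.FinitePresentation Λ A] [Algebra.FinitePresentation Λ B]
    {f : R₀ →+* A} {g : R₀ →+* B} {p : Ideal A} {q : Ideal B} [p.IsPrime] [q.IsPrime]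
    (h : AreSmoothEquivalent f g p q)
    (hΛ : ∀ (D : Type u) [CommRing D] [Algebra A D] [Algebra B D],
      (algebraMap A D).comp f = (algebraMap B D).comp g → Algebra.Smooth A D → Algebra.Smooth B D →
        (algebraMap A D).comp (algebraMap Λ A) = (algebraMap B D).comp (algebraMap Λ B))
    (hq : Algebra.IsSmoothAt Λ q) : Algebra.IsSmoothAt Λ p := by
  obtain ⟨D, _, _, _, hcomp, hA, hB, r, hr, hrp, hrq⟩ := h
  -- the two `Λ`-structures on `D` (through `A` and through `B`) agree
  letI : Algebra Λ D := ((algebraMap A D).comp (algebraMap Λ A)).toAlgebra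
  haveI : IsScalarTower Λ A D := IsScalarTower.of_algebraMap_eq (fun _ => rfl)
  haveI : IsScalarTower Λ B D :=
    IsScalarTower.of_algebraMap_eq' (hΛ D hcomp hA hB)
  -- `D` is `Λ`-smooth at `r`: `B_q → D_r` is formally smooth, `B_q` is `Λ`-formally smooth
  haveI : Algebra.IsSmoothAt Λ r := by
    change Algebra.FormallySmooth Λ (Localization.AtPrime r)
    haveI hqr : r.LiesOver q := ⟨hrq.symm⟩
    letI := Localization.AtPrime.algebraOfLiesOver q r
    haveI : Algebra.FormallySmooth B (Localization.AtPrime r) := inferInstance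
    haveI : Algebra.FormallySmooth (Localization.AtPrime q) (Localization.AtPrime r) :=
      Algebra.FormallySmooth.localization_base (Rₘ := Localization.AtPrime q)
        (Sₘ := Localization.AtPrime r) q.primeCompl
    haveI : Algebra.FormallySmooth Λ (Localization.AtPrime q) := hq
    exact .comp Λ (Localization.AtPrime q) (Localization.AtPrime r)
  subst hrp
  exact isSmoothAt_comap_of_smooth (Λ := Λ) (A := A) r

/-- `isSmoothAt_of_isSmoothAt'` for `Λ`-algebras `R₀ → A`, `R₀ → B`: smooth-equivalent over
`S` to a `Λ`-smooth point ⇒ `Λ`-smooth — PROVED unconditionally (this is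
`AreSmoothEquivalent.isSmoothAt_left` without the hypothesis `Stacks05B5`).
[cite: StacksProject, Tag 05B5] -/
theorem isSmoothAt_of_isSmoothAt [Algebra Λ R₀] [Algebra Λ A] [Algebra Λ B]
    [Algebra.FinitePresentation Λ A] [Algebra.FinitePresentation Λ B]
    {f : R₀ →ₐ[Λ] A} {g : R₀ →ₐ[Λ] B} {p : Ideal A} {q : Ideal B} [p.IsPrime] [q.IsPrime]
    (h : AreSmoothEquivalent (f : R₀ →+* A) (g : R₀ →+* B) p q) (hq : Algebra.IsSmoothAt Λ q) :
    Algebra.IsSmoothAt Λ p := by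
  refine isSmoothAt_of_isSmoothAt' h (fun D _ _ _ hcomp _ _ => ?_) hq
  ext c
  have hf : algebraMap Λ A c = f (algebraMap Λ R₀ c) := (f.commutes c).symm
  have hg : algebraMap Λ B c = g (algebraMap Λ R₀ c) := (g.commutes c).symm
  rw [RingHom.comp_apply, RingHom.comp_apply, hf, hg]
  exact congrArg (fun φ : R₀ →+* D => φ (algebraMap Λ R₀ c)) hcomp

end AreSmoothEquivalent

end Pointwise

end Literature.AlgebraicGeometry.Resolution
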